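import Summits.QuantumFields.Balaban3D.Carriers.OldTerms
import Summits.QuantumFields.Balaban3D.Proofs.TorusBalls
import Summits.QuantumFields.Balaban3D.Proofs.OldOutsideShells

/-!
# `Balaban3D.Proofs.OldTermsCount` — the CARRIER COUNT behind [B10] p. 272 L28–31 («… by O(1)|Z_k|»): on seat p1's
# (43) index geometry `Carriers.OldTerms` (v1.1), the number of scale-`j` sites of `T^{(j)}` within scale-`j` distance `R`
# of the complement of the new region `Ω_{k+1}(h)^{(j)}` is at most `(2(R+1))³ · L^{3(k−j)} · |Z_k(h)|`

Lane «pub-balaban3d», seat p5; LEAF-LEDGER row C10 (the `hcount` input of `OldOutsideDropped.oldOutside_of_bound44` at the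
concrete carriers).  Pure combinatorics of `Setup`'s tori and p1's regions; nothing of [B10] = [Balaban1985UV3] is asserted.
Mechanism: (i) labels along coarsening, `(coarsen (j+i) x).val = (coarsen j x).val / L^i` (LQB `TorusGeometry.Site.val_blockOf`
iterated), so big-block labels are NESTED and `Z_k(h) = Ω_{k+1}(h)ᶜ` is a union of scale-`j` big blocks for every `j ≤ k+1`
(p1 `Omega_bigBlock`); (ii) hence a scale-`j` site outside `newSites h j` lies over `Z_k(h)`; (iii) FIBRE COUNT
`#{u ∈ T^{(j)} over Z} ≤ L^{3(k−j)} · #{w ∈ T^{(k)} over Z}` (LQB `card_block`); (iv) ball count on the torus (seat p2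
`TorusBalls.card_torusBall_le`); (v) §5 the one-bond lattice sum at half rate `Σ_b e^{−a|b₋−y₀|}|b₋−y₀| ≤ Z′(a)` (the `hZ′`
input; layer-cake over torus balls, `OldOutsideShells.sum_exp_neg_dist_le_finset`/`shell_series_le`).
[cite: Balaban1985UV3, Thm 2 proof p.272 L28–31]
-/

open Finset

namespace Summit.QuantumFields.Balaban3D.Proofs

open Literature.MathematicalPhysics.QuantumFieldTheory.Balaban1983to89
open Summit.QuantumFields.Balaban3D.Carriers
open Summit.QuantumFields.Balaban3D.Proofs.TorusBalls (card_torusBall_le)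

variable {P : Params}

/-! ## §1 Labels along coarsening; nested big-block labels -/

/-- `(coarsen (j+i) x)_μ = (coarsen j x)_μ / L^i` on labels (standing range `j + i ≤ m + K`). [folklore] -/
theorem val_coarsen_add (j : ℕ) : ∀ (i : ℕ), j + i ≤ P.m + P.K → ∀ (x : Site P 0) (μ : Fin P.d),
    ((coarsen (j + i) x) μ).val = ((coarsen j x) μ).val / P.L ^ i
  | 0, _, x, μ => by simp
  | i + 1, hi, x, μ => by
    show ((blockOf (coarsen (j + i) x)) μ).val = _
    rw [Site.val_blockOf (by omega), val_coarsen_add j i (by omega) x μ, Nat.div_div_eq_div_mul, pow_succ]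

/-- NESTED LABELS: equal scale-`j` big-block labels imply equal scale-`k'` big-block labels for `j ≤ k' ≤ m + K`. [folklore] -/
theorem bigBlockOf_eq_of_le (M₁ : ℕ) {j k' : ℕ} (hjk : j ≤ k') (hk : k' ≤ P.m + P.K) {x x' : Site P 0}
    (h : bigBlockOf M₁ j x = bigBlockOf M₁ j x') : bigBlockOf M₁ k' x = bigBlockOf M₁ k' x' := by
  obtain ⟨i, rfl⟩ := Nat.exists_eq_add_of_le hjk
  funext μ
  have hμ := congrFun h μ
  simp only [bigBlockOf] at hμ ⊢
  rw [val_coarsen_add j i hk x μ, val_coarsen_add j i hk x' μ, Nat.div_div_eq_div_mul, Nat.div_div_eq_div_mul,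
    mul_comm (P.L ^ i) M₁, ← Nat.div_div_eq_div_mul, ← Nat.div_div_eq_div_mul, hμ]

/-! ## §2 Scale-`j` sites outside the new region lie over `Z_k(h)` -/

/-- If the scale-`j` site `z` is NOT in `newSites h j` (its big block is not inside `Ω_{k+1}(h)`), then EVERY fine site over
`z` lies in `Z_k(h) = Ω_{k+1}(h)ᶜ` — because `Ω_{k+1}(h)` is a union of scale-`(k+1)` big blocks (p1 `Omega_bigBlock`) and
the labels are nested (`j ≤ k + 1 ≤ m + K`). [cite: Balaban1985UV3, (39)–(40) p.266] -/
theorem mem_Zreg_of_not_mem_newSites (M₁ : ℕ) (Rcol : ℕ → ℕ) {k : ℕ} (h : Hist P (k + 1)) {j : ℕ}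
    (hj : j ≤ k + 1) (hk : k + 1 ≤ P.m + P.K) {z : Site P j} (hz : z ∉ newSites M₁ Rcol h j)
    {x : Site P 0} (hx : coarsen j x = z) : x ∈ Zreg M₁ Rcol h k := by
  unfold newSites at hz
  rw [mem_bigIn, not_forall] at hz
  obtain ⟨x', hx'⟩ := hz
  rw [Classical.not_imp] at hx'
  obtain ⟨hx', hx'Ω⟩ := hx'
  have hlab : bigBlockOf M₁ j x = bigBlockOf M₁ j x' := by
    rw [hx', bigBlockOf_eq_bigLabel, hx]
  have hlab' := bigBlockOf_eq_of_le M₁ hj hk hlab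
  intro hxΩ
  exact hx'Ω ((Omega_bigBlock M₁ Rcol (k + 1) h (k + 1) (by omega) le_rfl x x' hlab').1 hxΩ)

open Classical in
/-- Hence the complement of `newSites h j` is contained in the scale-`j` trace of `Z_k(h)` (every scale-`j` site has a fine
site over it, p1 `coarsen_surjective`). [folklore] -/
theorem compl_newSites_subset (M₁ : ℕ) (Rcol : ℕ → ℕ) {k : ℕ} (h : Hist P (k + 1)) {j : ℕ}
    (hj : j ≤ k + 1) (hk : k + 1 ≤ P.m + P.K) :
    (univ \ newSites M₁ Rcol h j) ⊆
      univ.filter (fun z : Site P j => ∃ x : Site P 0, coarsen j x = z ∧ x ∈ Zreg M₁ Rcol h k) := by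
  intro z hz
  rw [mem_sdiff] at hz
  obtain ⟨x, hx⟩ := coarsen_surjective j (by omega) z
  exact mem_filter.2 ⟨mem_univ _, x, hx, mem_Zreg_of_not_mem_newSites M₁ Rcol h hj hk hz.2 hx⟩

/-! ## §3 Fibre count along coarsening -/

open Classical in
/-- **FIBRE COUNT**: the scale-`j` trace of a set of fine sites has at most `L^{d(k−j)}` times as many sites as its
scale-`k` trace (`j ≤ k ≤ m + K`; LQB `card_block`: a block of order 1 has `L^d` sites). [folklore] -/
theorem card_trace_le (Z : Set (Site P 0)) (j : ℕ) :
    ∀ k, j ≤ k → k ≤ P.m + P.K →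
      (univ.filter (fun u : Site P j => ∃ x : Site P 0, coarsen j x = u ∧ x ∈ Z)).card ≤
        P.L ^ (P.d * (k - j)) * (univ.filter (fun w : Site P k => ∃ x : Site P 0, coarsen k x = w ∧ x ∈ Z)).card := by
  refine Nat.le_induction ?_ ?_
  · intro _
    simp only [Nat.sub_self, mul_zero, pow_zero, one_mul]
    exact le_rfl
  · intro k hjk IH hk
    have IH' := IH (by omega)
    -- the scale-`k` trace sits inside the union of the blocks of the scale-`(k+1)` trace
    have hsub : univ.filter (fun w : Site P k => ∃ x : Site P 0, coarsen k x = w ∧ x ∈ Z) ⊆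
        (univ.filter (fun w' : Site P (k + 1) => ∃ x : Site P 0, coarsen (k + 1) x = w' ∧ x ∈ Z)).biUnion
          (fun w' => block w') := by
      intro w hw
      rw [mem_filter] at hw
      obtain ⟨x, hx, hxZ⟩ := hw.2
      rw [mem_biUnion]
      refine ⟨blockOf w, mem_filter.2 ⟨mem_univ _, x, ?_, hxZ⟩, ?_⟩
      · rw [coarsen_succ, hx]
      · simp [block]
    have hstep : (univ.filter (fun w : Site P k => ∃ x : Site P 0, coarsen k x = w ∧ x ∈ Z)).card ≤
        P.L ^ P.d * (univ.filter (fun w' : Site P (k + 1) => ∃ x : Site P 0, coarsen (k + 1) x = w' ∧ x ∈ Z)).card := by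
      refine (card_le_card hsub).trans (card_biUnion_le.trans ?_)
      rw [mul_comm, sum_const_nat fun w' _ => Site.card_block hk w']
    calc (univ.filter (fun u : Site P j => ∃ x : Site P 0, coarsen j x = u ∧ x ∈ Z)).card
        ≤ P.L ^ (P.d * (k - j)) * (univ.filter (fun w : Site P k => ∃ x : Site P 0, coarsen k x = w ∧ x ∈ Z)).card :=
          IH'
      _ ≤ P.L ^ (P.d * (k - j)) * (P.L ^ P.d *
          (univ.filter (fun w' : Site P (k + 1) => ∃ x : Site P 0, coarsen (k + 1) x = w' ∧ x ∈ Z)).card) :=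
          Nat.mul_le_mul_left _ hstep
      _ = P.L ^ (P.d * (k + 1 - j)) *
          (univ.filter (fun w' : Site P (k + 1) => ∃ x : Site P 0, coarsen (k + 1) x = w' ∧ x ∈ Z)).card := by
          rw [← mul_assoc, ← pow_add]
          congr 2
          rw [Nat.sub_add_comm hjk, Nat.mul_succ]

/-! ## §4 The count near the complement of the new region -/

open Classical in
/-- **THE COUNT**: the scale-`j` sites within distance `R` of the complement of `newSites h j` number at most
`(2(R+1))^d · L^{d(k−j)} · |Z_k(h)|` (`j ≤ k`, `k + 1 ≤ m + K`; `|Z_k(h)|` = p1 `ZVol … (k+1) h k`, sites of `T^{(k)}` over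
`Ω_{k+1}(h)ᶜ`). [cite: Balaban1985UV3, Thm 2 proof p.272 L28–31] -/
theorem card_near_compl_newSites_le (M₁ : ℕ) (Rcol : ℕ → ℕ) {k : ℕ} (h : Hist P (k + 1)) {j : ℕ}
    (hj : j ≤ k) (hk : k + 1 ≤ P.m + P.K) (R : ℕ) :
    (univ.filter (fun y : Site P j => ∃ z, z ∉ newSites M₁ Rcol h j ∧ Site.tdist z y ≤ R)).card ≤
      (2 * (R + 1)) ^ P.d * (P.L ^ (P.d * (k - j)) * ZVol M₁ Rcol (k + 1) h k) := by
  have hsub : univ.filter (fun y : Site P j => ∃ z, z ∉ newSites M₁ Rcol h j ∧ Site.tdist z y ≤ R) ⊆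
      (univ \ newSites M₁ Rcol h j).biUnion (fun z => univ.filter fun y => Site.tdist z y ≤ R) := by
    intro y hy
    rw [mem_filter] at hy
    obtain ⟨z, hz, hzy⟩ := hy.2
    exact mem_biUnion.2 ⟨z, mem_sdiff.2 ⟨mem_univ _, hz⟩, mem_filter.2 ⟨mem_univ _, hzy⟩⟩
  have hZ : (univ \ newSites M₁ Rcol h j).card ≤ P.L ^ (P.d * (k - j)) * ZVol M₁ Rcol (k + 1) h k := by
    refine (card_le_card (compl_newSites_subset M₁ Rcol h (by omega) hk)).trans ?_
    have := card_trace_le (Zreg M₁ Rcol h k) j k hj (by omega)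
    unfold ZVol
    exact this
  calc (univ.filter (fun y : Site P j => ∃ z, z ∉ newSites M₁ Rcol h j ∧ Site.tdist z y ≤ R)).card
      ≤ ((univ \ newSites M₁ Rcol h j).biUnion (fun z => univ.filter fun y => Site.tdist z y ≤ R)).card :=
        card_le_card hsub
    _ ≤ ∑ z ∈ univ \ newSites M₁ Rcol h j, (univ.filter fun y : Site P j => Site.tdist z y ≤ R).card :=
        card_biUnion_le
    _ ≤ ∑ _z ∈ univ \ newSites M₁ Rcol h j, (2 * (R + 1)) ^ P.d := sum_le_sum fun z _ => card_torusBall_le z R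
    _ = (univ \ newSites M₁ Rcol h j).card * (2 * (R + 1)) ^ P.d := sum_const_nat fun _ _ => rfl
    _ ≤ (P.L ^ (P.d * (k - j)) * ZVol M₁ Rcol (k + 1) h k) * (2 * (R + 1)) ^ P.d := Nat.mul_le_mul_right _ hZ
    _ = (2 * (R + 1)) ^ P.d * (P.L ^ (P.d * (k - j)) * ZVol M₁ Rcol (k + 1) h k) := mul_comm _ _

/-! ## §5 The one-bond lattice sum at half rate (`hZ′` of `OldOutsideDropped`) on `Setup`'s 3-torus -/

section BondSum

variable {j : ℕ}

/-- `t·e^{−at} ≤ (2/a)·e^{−(a/2)t}` for `a > 0`. [folklore] -/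
theorem mul_exp_neg_le {a t : ℝ} (ha : 0 < a) :
    Real.exp (-(a * t)) * t ≤ 2 / a * Real.exp (-(a / 2 * t)) := by
  have h1 : a / 2 * t ≤ Real.exp (a / 2 * t) := by
    have := Real.add_one_le_exp (a / 2 * t); linarith
  have h2 : t ≤ 2 / a * Real.exp (a / 2 * t) := by
    rw [div_mul_eq_mul_div, le_div_iff₀ ha]
    nlinarith
  have h3 : Real.exp (-(a * t)) * t ≤ Real.exp (-(a * t)) * (2 / a * Real.exp (a / 2 * t)) :=
    mul_le_mul_of_nonneg_left h2 (Real.exp_pos _).le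
  calc Real.exp (-(a * t)) * t ≤ Real.exp (-(a * t)) * (2 / a * Real.exp (a / 2 * t)) := h3
    _ = 2 / a * (Real.exp (-(a * t)) * Real.exp (a / 2 * t)) := by ring
    _ = 2 / a * Real.exp (-(a / 2 * t)) := by rw [← Real.exp_add]; ring_nf

/-- Bonds whose source lies in a torus ball: at most `d · (2(r+1))^d` (the source map has fibres of size `d`; seat p2's ball
count). [folklore] -/
theorem card_bonds_src_ball_le (y₀ : Site P j) (r : ℕ) :
    ((univ : Finset (PBond P j)).filter (fun b => Site.tdist b.src y₀ ≤ r)).card ≤ P.d * (2 * (r + 1)) ^ P.d := by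
  classical
  have hinj : Set.InjOn (fun b : PBond P j => (b.src, b.dir))
      ↑((univ : Finset (PBond P j)).filter (fun b => Site.tdist b.src y₀ ≤ r)) := by
    rintro ⟨s, d⟩ _ ⟨s', d'⟩ _ h
    simp only [Prod.mk.injEq] at h
    rw [h.1, h.2]
  have hmaps : Set.MapsTo (fun b : PBond P j => (b.src, b.dir))
      ↑((univ : Finset (PBond P j)).filter (fun b => Site.tdist b.src y₀ ≤ r))
      ↑(((univ : Finset (Site P j)).filter (fun x => Site.tdist y₀ x ≤ r)) ×ˢ (univ : Finset (Fin P.d))) := by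
    intro b hb
    rw [mem_coe, mem_filter] at hb
    rw [mem_coe, mem_product, mem_filter]
    -- symmetry of the torus `ℓ¹` distance, inline (LQB `B3Taylor310LocalRemainder.tdist_comm` states it; not imported here)
    have hsymm : Site.tdist y₀ b.src = Site.tdist b.src y₀ := by
      unfold Site.tdist; exact sum_congr rfl fun μ _ => min_comm _ _
    exact ⟨⟨mem_univ _, by rw [hsymm]; exact hb.2⟩, mem_univ _⟩
  calc ((univ : Finset (PBond P j)).filter (fun b => Site.tdist b.src y₀ ≤ r)).card
      ≤ (((univ : Finset (Site P j)).filter (fun x => Site.tdist y₀ x ≤ r)) ×ˢ (univ : Finset (Fin P.d))).card :=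
        card_le_card_of_injOn _ hmaps hinj
    _ = ((univ : Finset (Site P j)).filter (fun x => Site.tdist y₀ x ≤ r)).card * P.d := by
        rw [card_product, card_univ, Fintype.card_fin]
    _ ≤ (2 * (r + 1)) ^ P.d * P.d := Nat.mul_le_mul_right _ (card_torusBall_le y₀ r)
    _ = P.d * (2 * (r + 1)) ^ P.d := mul_comm _ _

/-- The bond-ball count in the `(m+1)³` shape for `d = 3`: `≤ 24(m+1)³`. [folklore] -/
theorem card_bonds_src_ball_le_real (hd : P.d = 3) (y₀ : Site P j) (m : ℕ) :
    (((univ : Finset (PBond P j)).filter (fun b => Site.tdist b.src y₀ ≤ m)).card : ℝ)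
      ≤ 24 * ((m : ℝ) + 1) ^ 3 * 1 := by
  have h := card_bonds_src_ball_le y₀ m
  rw [hd] at h
  have h' : (((univ : Finset (PBond P j)).filter (fun b => Site.tdist b.src y₀ ≤ m)).card : ℝ)
      ≤ ((3 * (2 * (m + 1)) ^ 3 : ℕ) : ℝ) := by exact_mod_cast h
  refine h'.trans (le_of_eq ?_)
  push_cast; ring

/-- **THE ONE-BOND SUM AT HALF RATE** (`hZ′` of `OldOutsideDropped.dropped_blockSum_le`) on the 3-torus: for any bond set,
`Σ_b e^{−a|b₋ − y₀|}·|b₋ − y₀| ≤ (2/a)·24·S(a/2)` with `S(κ) = 48/κ³·e^{κ/2}/(1 − e^{−κ/2})` (layer-cake over torus balls: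
`OldOutsideShells.sum_exp_neg_dist_le_finset` + `shell_series_le`). [folklore] -/
theorem bondSum_le (hd : P.d = 3) (s : Finset (PBond P j)) (y₀ : Site P j) {a : ℝ} (ha : 0 < a) :
    ∑ b ∈ s, Real.exp (-(a * Site.tdist b.src y₀)) * (Site.tdist b.src y₀ : ℝ) ≤
      2 / a * (24 * (48 / (a / 2) ^ 3 * Real.exp (a / 2 / 2) / (1 - Real.exp (-(a / 2 / 2)))) * 1) := by
  have hcount := card_bonds_src_ball_le_real hd y₀
  have hS := fun M : ℕ => shell_series_le (half_pos ha) M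
  have key := sum_exp_neg_dist_le_finset (univ : Finset (PBond P j)) (fun b => Site.tdist b.src y₀)
    (by norm_num : (0 : ℝ) ≤ 24) zero_le_one hcount hS
  have step1 : ∑ b ∈ s, Real.exp (-(a * Site.tdist b.src y₀)) * (Site.tdist b.src y₀ : ℝ)
      ≤ ∑ b : PBond P j, Real.exp (-(a * Site.tdist b.src y₀)) * (Site.tdist b.src y₀ : ℝ) :=
    sum_le_sum_of_subset_of_nonneg (subset_univ s) fun b _ _ =>
      mul_nonneg (Real.exp_pos _).le (Nat.cast_nonneg _)
  have step2 : ∑ b : PBond P j, Real.exp (-(a * Site.tdist b.src y₀)) * (Site.tdist b.src y₀ : ℝ)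
      ≤ ∑ b : PBond P j, 2 / a * Real.exp (-(a / 2 * Site.tdist b.src y₀)) :=
    sum_le_sum fun b _ => mul_exp_neg_le ha
  have step3 : ∑ b : PBond P j, 2 / a * Real.exp (-(a / 2 * Site.tdist b.src y₀))
      = 2 / a * ∑ b : PBond P j, Real.exp (-(a / 2 * Site.tdist b.src y₀)) := by rw [mul_sum]
  have step4 : 2 / a * ∑ b : PBond P j, Real.exp (-(a / 2 * (Site.tdist b.src y₀ : ℝ)))
      ≤ 2 / a * (24 * (48 / (a / 2) ^ 3 * Real.exp (a / 2 / 2) / (1 - Real.exp (-(a / 2 / 2)))) * 1) :=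
    mul_le_mul_of_nonneg_left key (div_nonneg zero_le_two ha.le)
  exact step1.trans (step2.trans (step3.le.trans step4))

end BondSum


/-! ## §6 Block counts against `|Ω_k^{(k)}|` (the `hcard` of (45)–(46) «Summation over y gives the factor (M₁L^jη)^{−3}|Λ_k|», helper for
seat p2's (46)-leaf `Bound46Series.bound46_series_of_steps` — the count enters at `Bound46Series.abs_poldIn_le` — lane ruling R-44 / batch 19; uses p1's R-LAMVOL-fixed `LamVol k h = |Ω_k(h)^{(k)}|`) -/

section NewSites

open Classical in
/-- `newSites h j ⊆ trace_j(Ω_{k+1}(h))`: a scale-`j` site whose big block lies in `Ω_{k+1}(h)` lies over `Ω_{k+1}(h)` (any fine site over it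
has its label; p1 `coarsen_surjective`, `j ≤ m + K`). [folklore] -/
theorem newSites_subset_trace (M₁ : ℕ) (Rcol : ℕ → ℕ) {k : ℕ} (h : Hist P (k + 1)) {j : ℕ} (hj : j ≤ P.m + P.K) :
    newSites M₁ Rcol h j ⊆
      univ.filter (fun u : Site P j => ∃ x : Site P 0, coarsen j x = u ∧ x ∈ Omega M₁ Rcol (k + 1) h (k + 1)) := by
  intro y hy
  obtain ⟨x, hx⟩ := coarsen_surjective j hj y
  refine mem_filter.2 ⟨mem_univ _, x, hx, ?_⟩
  unfold newSites at hy
  exact (mem_bigIn M₁).1 hy x (by rw [bigBlockOf_eq_bigLabel, hx])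

/-- **`#newSites h j ≤ L^{d(k+1−j)} · |Ω_{k+1}(h)^{(k+1)}|`** (p1 `LamVol … (k+1) h`, R-LAMVOL-fixed): the scale-`j` sites with big block inside
`Ω_{k+1}(h)` are at most the scale-`j` trace of `Ω_{k+1}(h)`, which the fibre count `card_trace_le` compares with its scale-`(k+1)` trace
(`j ≤ k + 1 ≤ m + K`).  Seat p2's `hcard` for the retained old blocks `oldBlocks h j ∩ newSites h j` (corners, a subset) follows by
`card_le_card`; the printed `(M₁L^jη)^{−3}` is this bound up to the factor `M₁³` (not load-bearing, LQB census C-B10-1). [cite: Balaban1985UV3, (45)–(46) p.267 L10–13] -/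
theorem card_newSites_le (M₁ : ℕ) (Rcol : ℕ → ℕ) {k : ℕ} (h : Hist P (k + 1)) {j : ℕ} (hj : j ≤ k + 1)
    (hk : k + 1 ≤ P.m + P.K) :
    (newSites M₁ Rcol h j).card ≤ P.L ^ (P.d * (k + 1 - j)) * LamVol M₁ Rcol (k + 1) h := by
  classical
  refine (card_le_card (newSites_subset_trace M₁ Rcol h (hj.trans hk))).trans ?_
  have := card_trace_le (Omega M₁ Rcol (k + 1) h (k + 1)) j (k + 1) hj hk
  unfold LamVol
  exact this

/-- The retained old blocks of (43)/(58) at the passage `k → k+1` — corners `y ∈ oldBlocks h j` whose block stays in `Ω_{k+1}(h)` —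
obey the same count. [cite: Balaban1985UV3, (45)–(46) p.267 L10–13] -/
theorem card_oldBlocks_inter_newSites_le (M₁ : ℕ) (Rcol : ℕ → ℕ) {k : ℕ} (h : Hist P (k + 1)) {j : ℕ} (hj : j ≤ k + 1)
    (hk : k + 1 ≤ P.m + P.K) :
    (oldBlocks M₁ Rcol h j ∩ newSites M₁ Rcol h j).card ≤ P.L ^ (P.d * (k + 1 - j)) * LamVol M₁ Rcol (k + 1) h :=
  (card_le_card inter_subset_right).trans (card_newSites_le M₁ Rcol h hj hk)

/-- Real-cast form with the printed normalisation: `#(oldBlocks ∩ newSites) ≤ M₁^d · (M₁·L^{−(k+1−j)})^{−d} · |Ω_{k+1}^{(k+1)}|`. [cite: Balaban1985UV3, (45)–(46) p.267 L10–13] -/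
theorem card_oldBlocks_inter_newSites_le_real (M₁ : ℕ) (Rcol : ℕ → ℕ) (hM : 0 < M₁) {k : ℕ} (h : Hist P (k + 1)) {j : ℕ}
    (hj : j ≤ k + 1) (hk : k + 1 ≤ P.m + P.K) :
    ((oldBlocks M₁ Rcol h j ∩ newSites M₁ Rcol h j).card : ℝ) ≤
      (M₁ : ℝ) ^ P.d * (((M₁ : ℝ) * ((P.L : ℝ)⁻¹) ^ (k + 1 - j))⁻¹ ^ P.d * (LamVol M₁ Rcol (k + 1) h : ℝ)) := by
  have h1 : ((oldBlocks M₁ Rcol h j ∩ newSites M₁ Rcol h j).card : ℝ) ≤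
      ((P.L ^ (P.d * (k + 1 - j)) * LamVol M₁ Rcol (k + 1) h : ℕ) : ℝ) := by
    exact_mod_cast card_oldBlocks_inter_newSites_le M₁ Rcol h hj hk
  refine h1.trans (le_of_eq ?_)
  have hM' : (M₁ : ℝ) ≠ 0 := by exact_mod_cast hM.ne'
  have hL : (P.L : ℝ) ≠ 0 := by exact_mod_cast P.L_pos.ne'
  push_cast
  rw [mul_inv, inv_pow, inv_inv, mul_pow, ← pow_mul, mul_comm (k + 1 - j) P.d, inv_pow, ← mul_assoc, ← mul_assoc,
    mul_inv_cancel₀ (pow_ne_zero _ hM'), one_mul]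

end NewSites

end Summit.QuantumFields.Balaban3D.Proofs
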